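/-
Copyright (c) 2026 the pub-hodgecm-mathlib formalisation cell (harness21).  Prover seat hodgecm-mathlib-F0P3a-p08 (g19): «S3-ram» seeding wave (LEAD F0P3a-plan (g12), owner
F0P3a-p06 (g15)), row (e2)(b) «[T2-c]-ram» (A-p19 (g26) PLAN-T2c-ram-layer3, inherited 22:13:38Z), LAYER 3 brick (ii-a) «THE ANTI-FIXED DEFECT `[R⁻ : ΠR^⋆] = q`»; 2026-09-01.
-/
import Literature.NumberTheory.Automorphic.QuadraticRamifiedOrderMonogenic      -- ★ p846557 (A-p19): `eval₂_cubic_eq_zero`, `mem_range_eval₂_iff`, `const_mem_range_eval₂`, `gen_mem_range_eval₂`, `exists_addEquiv_pi_three`, `addEquiv_mulVec_coordMatrix`, `valuation_det_coordMatrix` (θ²-agnostic)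
import Literature.NumberTheory.Automorphic.RamifiedCoordinateModelAntiFixed       -- ★ p846944 (A-p19): `map_eq_self_iff_of_coord`, `map_add_self_eq_zero_iff_of_coord` (fixed ∕ anti-fixed parts of the ramified coordinate model)
import Literature.NumberTheory.Automorphic.VandermondeLatticeIndex               -- ★ `natCard_quotient_span_singleton_of_valuation_eq`
import Mathlib.LinearAlgebra.Matrix.Nondegenerate
import Mathlib.GroupTheory.Index
import HarnessLib

/-!
# The `⋆`-adapted basis `{1, x, x⁻¹}` of the type-(2) order `R = 𝒪_E[x]` and the anti-fixed defect `[R⁻ : Π·R^⋆] = q` at a TAMELY RAMIFIED base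
# (Neukirch, *Algebraic Number Theory* I §12; Serre, *Local Fields* Ch. I §6, Ch. V §3)

Topic `NumberTheory/Automorphic`; namespace `Literature.NumberTheory.Automorphic`.  THEOREMS ONLY (no definition, no instance, no notation, no named fact, no `sorry`); (D0)
currency of ★ p846557 ∕ p846912 (`[Field E] [ValuativeRel E]`, abstract `O₁` with `j : 𝒪[E] →+* O₁`, `θ`, unique coordinates; `x = (u, λ) ∈ Λ = 𝒪[E] × O₁`,
`R = 𝒪[E][x]` = the range of `eval₂ (id, j) x`) PLUS the layer-3 involution data: `σO` on `𝒪[E]`, `σ₁` on `O₁` over it (`σ₁ ∘ j = j ∘ σO`), `⋆ = (σO, σ₁)` on `Λ` with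
`x·x⋆ = 1`, and the TAME-RAMIFIED base `F`: `ιO : 𝒪[F] →+* 𝒪[E]` with `σO ∘ ιO = ιO`, unique coordinates `𝒪[E] = ιO𝒪[F] ⊕ ιO𝒪[F]·Π` on the ANTI-FIXED uniformiser `Π`
(`σO Π = −Π`) — the shape of ★ p846944.  Cell `pub/hodgecm-mathlib` (D-0151), crux H413 = `stmt-HodgeConjecture-24833`; «S3-ram» seeding wave, row (e2)(b) «[T2-c]-ram» LAYER 3
(A-p19 (g26) PLAN-T2c-ram-layer3 step (ii-a); CERT «[T2-c]-ram» 22:10Z).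
HONEST LABEL: HC_CM is proved only modulo the 2 remaining named inputs (hLiu418 24832, h413 24833) until rung 0 closes; unconditional commutative algebra, count-neutral.

THE MATHEMATICS.  `x⁻¹ = x⋆ ∈ R` and the monic cubic `x³ − (t+u)x² + (D+tu)x − uD = 0` (★ `eval₂_cubic_eq_zero`) give `x² = (t+u)x − (D+tu) + uD·x⁻¹`, so `R = 𝒪_E·1 ⊕ 𝒪_E·x ⊕ 𝒪_E·x⁻¹`
with UNIQUE coordinates (§1; uniqueness from the non-vanishing determinant `e₂·y·χ(u)` of ★ p846557's coordinate matrix).  In this basis `⋆` acts by `(d₀, d₁, d₂) ↦ (σd₀, σd₂, σd₁)`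
(`⋆` is `σO` on constants and swaps `x ↔ x⁻¹`), whence (§2)
  `R^⋆ = {ιO b + d·x + σd·x⁻¹}`,   `R⁻ = {ιO b·Π + d·x − σd·x⁻¹}`   (`b ∈ 𝒪_F`, `d ∈ 𝒪_E`; ★ p846944: `𝒪_E^σ = ιO𝒪_F`, `𝒪_E⁻ = ιO𝒪_F·Π`),
and `Π·(ιO b + d x + σd x⁻¹) = ιO b·Π + (Πd)·x − σ(Πd)·x⁻¹` (as `σΠ = −Π`).  So along the injective parametrisation `α⁻ : 𝒪_F × 𝒪_E → R⁻` the subgroup `Π·R^⋆` is the image of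
`𝒪_F × Π𝒪_E`, and **`[R⁻ : Π·R^⋆] = [𝒪_E : Π𝒪_E] = #𝓀_E = q`** (§3) — the defect of A-p19's identity ★ `index_mul_relIndex_map_eq_sq_mul`
(`[Λ : R]·[R⁻ : ΠR^⋆] = [Λ^⋆ : R^⋆]²·[Λ⁻ : ΠΛ^⋆]`), in ITS spelling: `R^⋆ = R.toAddSubgroup ⊓ (eqLocus ⋆ id).toAddSubgroup`, `R⁻ = R.toAddSubgroup ⊓ ker (⋆ + id)`,
`ΠR^⋆ = (R^⋆).map (mulLeft (Π, jΠ))`.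

* §1 `inv_gen_mem_range_eval₂`, `gen_sq_eq`, `exists_inv_coord_of_mem_range`, `threeTerm_injective`, `inv_coord_injective`, `star_const`, `star_inv_gen`.
* §2 `mem_inf_fixed_iff_exists`, `mem_inf_anti_iff_exists`.
* §3 **`relIndex_map_mulLeft_fixed_anti_eq_natCard`** (`[R⁻ : ΠR^⋆] = Nat.card 𝓀[E]`).

## References
* [Neukirch1999] J. Neukirch, *Algebraic Number Theory*, Grundlehren 322 (1999): Ch. I §12 (orders, conductor, additive indices).
* [SerreLocalFields1979] J.-P. Serre, *Local Fields*, GTM 67 (1979): Ch. I §6 Prop. 17–18 (integral bases of tamely ramified quadratic extensions), Ch. V §3.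
* [Hungerford1974] T. W. Hungerford, *Algebra*, GTM 73 (1974): Ch. I Thm. 4.5 (index multiplicativity).
-/

set_option autoImplicit false

noncomputable section

open scoped ValuativeRel
open Polynomial Matrix ValuativeRel

namespace Literature.NumberTheory.Automorphic

variable {F E : Type*} [Field F] [ValuativeRel F] [Field E] [ValuativeRel E] {O₁ : Type*} [CommRing O₁]
  (ιO : 𝒪[F] →+* 𝒪[E]) (σO : 𝒪[E] →+* 𝒪[E]) (j : 𝒪[E] →+* O₁) (σ₁ : O₁ →+* O₁) (θ : O₁) {k₀ : 𝒪[E]}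
  (u : 𝒪[E]) {t y D e₂ : 𝒪[E]} {lam : O₁}

/-! ## §1 The `⋆`-adapted basis `{1, x, x⁻¹}` of `R` -/

/-- `x⋆ = x⁻¹ ∈ R`: the inverse of `x = (u, λ)` is `x² − (t+u)x + (D+tu)` times the unit-inverse of `uD`… — here obtained abstractly: `x⋆·x = 1` and `x⋆ = (uD)⁻¹·(x² − (t+u)x + (D+tu))`
from the cubic, all three summands in `R`.  Stated: any `xi` with `x·xi = 1` lies in `R` provided `uD` is a unit. [cite: Neukirch1999, Ch. I §12] -/
theorem inv_gen_mem_range_eval₂ (hθ : θ ^ 2 = j k₀) (h2 : e₂ * 2 = 1) (hD : 4 * D = t * t - y * y * k₀) (hlam : lam = j (e₂ * t) + j (e₂ * y) * θ)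
    (huD : IsUnit (u * D)) {xi : 𝒪[E] × O₁} (hxi : ((u, lam) : 𝒪[E] × O₁) * xi = 1) :
    xi ∈ (Polynomial.eval₂RingHom (RingHom.prod (RingHom.id 𝒪[E]) j) ((u, lam) : 𝒪[E] × O₁)).range := by
  set R := (Polynomial.eval₂RingHom (RingHom.prod (RingHom.id 𝒪[E]) j) ((u, lam) : 𝒪[E] × O₁)).range with hR
  set κ : 𝒪[E] →+* 𝒪[E] × O₁ := RingHom.prod (RingHom.id 𝒪[E]) j with hκ
  set x : 𝒪[E] × O₁ := (u, lam) with hx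
  have hcub := eval₂_cubic_eq_zero j θ hθ u h2 hD hlam
  simp only [eval₂_add, eval₂_mul, eval₂_C, eval₂_X_pow, eval₂_X] at hcub
  -- `xi = (uD)⁻¹ (x² − (t+u) x + (D + tu))`
  obtain ⟨w, hw⟩ := huD
  have key : xi = κ (↑w⁻¹ : 𝒪[E]) * (x ^ 2 - κ (t + u) * x + κ (D + t * u)) := by
    have h1 : κ (u * D) = x * (x ^ 2 - κ (t + u) * x + κ (D + t * u)) := by
      have : κ 1 * x ^ 3 + κ (-(t + u)) * x ^ 2 + κ (D + t * u) * x + κ (-(u * D)) = 0 := hcub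
      rw [map_one, one_mul, map_neg, map_neg] at this
      linear_combination -this
    have h2' : κ (↑w⁻¹ : 𝒪[E]) * κ (u * D) = 1 := by rw [← map_mul, ← hw, Units.inv_mul, map_one]
    calc xi = (κ (↑w⁻¹ : 𝒪[E]) * κ (u * D)) * xi := by rw [h2', one_mul]
      _ = κ (↑w⁻¹ : 𝒪[E]) * (x ^ 2 - κ (t + u) * x + κ (D + t * u)) * (x * xi) := by rw [h1]; ring
      _ = _ := by rw [hxi, mul_one]
  rw [key]
  refine R.mul_mem (const_mem_range_eval₂ j u _) (R.add_mem (R.sub_mem (R.pow_mem (gen_mem_range_eval₂ j u) 2)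
    (R.mul_mem (const_mem_range_eval₂ j u _) (gen_mem_range_eval₂ j u))) (const_mem_range_eval₂ j u _))

/-- **`x² = (t+u)·x − (D+tu) + uD·x⁻¹`** (the cubic multiplied by `x⁻¹`). [cite: Neukirch1999, Ch. I §12] -/
theorem gen_sq_eq (hθ : θ ^ 2 = j k₀) (h2 : e₂ * 2 = 1) (hD : 4 * D = t * t - y * y * k₀) (hlam : lam = j (e₂ * t) + j (e₂ * y) * θ)
    {xi : 𝒪[E] × O₁} (hxi : ((u, lam) : 𝒪[E] × O₁) * xi = 1) :
    ((u, lam) : 𝒪[E] × O₁) ^ 2 = RingHom.prod (RingHom.id 𝒪[E]) j (t + u) * (u, lam) - RingHom.prod (RingHom.id 𝒪[E]) j (D + t * u) +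
      RingHom.prod (RingHom.id 𝒪[E]) j (u * D) * xi := by
  set κ : 𝒪[E] →+* 𝒪[E] × O₁ := RingHom.prod (RingHom.id 𝒪[E]) j with hκ
  set x : 𝒪[E] × O₁ := (u, lam) with hx
  have hcub := eval₂_cubic_eq_zero j θ hθ u h2 hD hlam
  simp only [eval₂_add, eval₂_mul, eval₂_C, eval₂_X_pow, eval₂_X] at hcub
  have : κ 1 * x ^ 3 + κ (-(t + u)) * x ^ 2 + κ (D + t * u) * x + κ (-(u * D)) = 0 := hcub
  rw [map_one, one_mul, map_neg, map_neg] at this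
  calc x ^ 2 = x ^ 2 * (x * xi) := by rw [hxi, mul_one]
    _ = (x ^ 3 + -κ (t + u) * x ^ 2 + κ (D + t * u) * x + -κ (u * D)) * xi + κ (t + u) * x * (x * xi) - κ (D + t * u) * (x * xi) + κ (u * D) * xi := by ring
    _ = _ := by rw [this, hxi, zero_mul, zero_add, mul_one, mul_one]

/-- **EVERY `r ∈ R` HAS `{1, x, x⁻¹}`-COORDINATES**: `r = κd₀ + κd₁·x + κd₂·x⁻¹` (from the three-term form and `gen_sq_eq`). [cite: Neukirch1999, Ch. I §12] -/
theorem exists_inv_coord_of_mem_range (hθ : θ ^ 2 = j k₀) (h2 : e₂ * 2 = 1) (hD : 4 * D = t * t - y * y * k₀) (hlam : lam = j (e₂ * t) + j (e₂ * y) * θ)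
    {xi : 𝒪[E] × O₁} (hxi : ((u, lam) : 𝒪[E] × O₁) * xi = 1) {r : 𝒪[E] × O₁}
    (hr : r ∈ (Polynomial.eval₂RingHom (RingHom.prod (RingHom.id 𝒪[E]) j) ((u, lam) : 𝒪[E] × O₁)).range) :
    ∃ d : Fin 3 → 𝒪[E], r = RingHom.prod (RingHom.id 𝒪[E]) j (d 0) + RingHom.prod (RingHom.id 𝒪[E]) j (d 1) * (u, lam) + RingHom.prod (RingHom.id 𝒪[E]) j (d 2) * xi := by
  obtain ⟨c, rfl⟩ := (mem_range_eval₂_iff j θ hθ u h2 hD hlam r).1 hr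
  have hsq := gen_sq_eq j θ u hθ h2 hD hlam hxi
  refine ⟨![c 0 - c 2 * (D + t * u), c 1 + c 2 * (t + u), c 2 * (u * D)], ?_⟩
  have hc : ∀ a : 𝒪[E], ((a, j a) : 𝒪[E] × O₁) = RingHom.prod (RingHom.id 𝒪[E]) j a := fun a => rfl
  simp only [Matrix.cons_val_zero, Matrix.cons_val_one, Matrix.cons_val_two, Matrix.tail_cons, Matrix.head_cons]
  rw [hc, hc, hc, hsq]
  simp only [map_sub, map_add, map_mul]
  ring

variable {ϖ : E} {n N : ℕ}

/-- **THREE-TERM COORDINATES ARE UNIQUE** (the coordinate matrix of ★ p846557 has determinant `e₂·y·χ(u)` of valuation `v(ϖ)^{N+n} ≠ 0`, and `𝒪[E]` is a domain).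
[cite: Neukirch1999, Ch. I §12] -/
theorem threeTerm_injective [IsDiscreteValuationRing 𝒪[E]] (hθ : θ ^ 2 = j k₀) (hcoord : ∀ z : O₁, ∃! bc : 𝒪[E] × 𝒪[E], z = j bc.1 + j bc.2 * θ)
    (h2 : e₂ * 2 = 1) (hD : 4 * D = t * t - y * y * k₀) (hlam : lam = j (e₂ * t) + j (e₂ * y) * θ) (hϖ : IsUniformizingElement ϖ)
    (hn : valuation E ((u * u - t * u + D : 𝒪[E]) : E) = valuation E ϖ ^ n) (hN : valuation E ((y : 𝒪[E]) : E) = valuation E ϖ ^ N)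
    {c c' : Fin 3 → 𝒪[E]}
    (h : ((c 0, j (c 0)) + (c 1, j (c 1)) * (u, lam) + (c 2, j (c 2)) * (u, lam) ^ 2 : 𝒪[E] × O₁) =
      (c' 0, j (c' 0)) + (c' 1, j (c' 1)) * (u, lam) + (c' 2, j (c' 2)) * (u, lam) ^ 2) : c = c' := by
  classical
  obtain ⟨Ψ, hΨ, -⟩ := exists_addEquiv_pi_three j θ hcoord
  set M : Matrix (Fin 3) (Fin 3) 𝒪[E] := !![1, u, u * u; 1, e₂ * t, e₂ * e₂ * (t * t + y * y * k₀); 0, e₂ * y, 2 * e₂ * e₂ * t * y] with hM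
  have hdetv : valuation E ((M.det : 𝒪[E]) : E) = valuation E ϖ ^ (N + n) := valuation_det_coordMatrix (k₀ := k₀) u h2 hD hn hN
  have hdet0 : M.det ≠ 0 := by
    intro h0
    have h' := hdetv
    rw [h0, ZeroMemClass.coe_zero, map_zero] at h'
    exact pow_ne_zero _ ((Valuation.ne_zero_iff _).2 hϖ.ne_zero) h'.symm
  have hΨc : Ψ (M *ᵥ c) = Ψ (M *ᵥ c') := by
    rw [addEquiv_mulVec_coordMatrix j θ hθ u h2 hD hlam Ψ hΨ, addEquiv_mulVec_coordMatrix j θ hθ u h2 hD hlam Ψ hΨ]; exact h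
  have hMc : M *ᵥ (c - c') = 0 := by rw [Matrix.mulVec_sub, Ψ.injective hΨc, sub_self]
  exact sub_eq_zero.1 (Matrix.eq_zero_of_mulVec_eq_zero hdet0 hMc)

/-- **`{1, x, x⁻¹}`-COORDINATES ARE UNIQUE**: multiply by `x` and use `threeTerm_injective` on the coordinates `(d₂, d₀, d₁)`. [cite: Neukirch1999, Ch. I §12] -/
theorem inv_coord_injective [IsDiscreteValuationRing 𝒪[E]] (hθ : θ ^ 2 = j k₀) (hcoord : ∀ z : O₁, ∃! bc : 𝒪[E] × 𝒪[E], z = j bc.1 + j bc.2 * θ)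
    (h2 : e₂ * 2 = 1) (hD : 4 * D = t * t - y * y * k₀) (hlam : lam = j (e₂ * t) + j (e₂ * y) * θ) (hϖ : IsUniformizingElement ϖ)
    (hn : valuation E ((u * u - t * u + D : 𝒪[E]) : E) = valuation E ϖ ^ n) (hN : valuation E ((y : 𝒪[E]) : E) = valuation E ϖ ^ N)
    {xi : 𝒪[E] × O₁} (hxi : ((u, lam) : 𝒪[E] × O₁) * xi = 1) {d d' : Fin 3 → 𝒪[E]}
    (h : RingHom.prod (RingHom.id 𝒪[E]) j (d 0) + RingHom.prod (RingHom.id 𝒪[E]) j (d 1) * (u, lam) + RingHom.prod (RingHom.id 𝒪[E]) j (d 2) * xi =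
      RingHom.prod (RingHom.id 𝒪[E]) j (d' 0) + RingHom.prod (RingHom.id 𝒪[E]) j (d' 1) * (u, lam) + RingHom.prod (RingHom.id 𝒪[E]) j (d' 2) * xi) : d = d' := by
  set κ : 𝒪[E] →+* 𝒪[E] × O₁ := RingHom.prod (RingHom.id 𝒪[E]) j with hκ
  set x : 𝒪[E] × O₁ := (u, lam) with hx
  have hc : ∀ a : 𝒪[E], ((a, j a) : 𝒪[E] × O₁) = κ a := fun a => rfl
  -- multiply by `x`: coordinates `(d₂, d₀, d₁)` in `{1, x, x²}`
  have hmul : (κ (d 2) + κ (d 0) * x + κ (d 1) * x ^ 2) = κ (d' 2) + κ (d' 0) * x + κ (d' 1) * x ^ 2 := by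
    have e1 : (κ (d 0) + κ (d 1) * x + κ (d 2) * xi) * x = κ (d 2) + κ (d 0) * x + κ (d 1) * x ^ 2 := by
      calc (κ (d 0) + κ (d 1) * x + κ (d 2) * xi) * x = κ (d 2) * (x * xi) + κ (d 0) * x + κ (d 1) * x ^ 2 := by ring
        _ = _ := by rw [hxi, mul_one]
    have e2 : (κ (d' 0) + κ (d' 1) * x + κ (d' 2) * xi) * x = κ (d' 2) + κ (d' 0) * x + κ (d' 1) * x ^ 2 := by
      calc (κ (d' 0) + κ (d' 1) * x + κ (d' 2) * xi) * x = κ (d' 2) * (x * xi) + κ (d' 0) * x + κ (d' 1) * x ^ 2 := by ring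
        _ = _ := by rw [hxi, mul_one]
    rw [← e1, ← e2, h]
  have key := threeTerm_injective j θ u hθ hcoord h2 hD hlam hϖ hn hN (c := ![d 2, d 0, d 1]) (c' := ![d' 2, d' 0, d' 1])
    (by simpa only [hc, Matrix.cons_val_zero, Matrix.cons_val_one, Matrix.cons_val] using hmul)
  funext i
  fin_cases i
  · exact congrFun key 1
  · exact congrFun key 2
  · exact congrFun key 0

/-- `⋆` on constants: `⋆(c, jc) = (σc, jσc)` (`σ₁ ∘ j = j ∘ σO`). [cite: SerreLocalFields1979, Ch. I §6] -/
theorem star_const (hσ₁j : ∀ a, σ₁ (j a) = j (σO a)) (c : 𝒪[E]) :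
    RingHom.prodMap σO σ₁ (RingHom.prod (RingHom.id 𝒪[E]) j c) = RingHom.prod (RingHom.id 𝒪[E]) j (σO c) := by
  change (σO c, σ₁ (j c)) = (σO c, j (σO c))
  rw [hσ₁j]

/-- `⋆x⁻¹ = x` when `x⁻¹ = ⋆x` and `⋆` is an involution. [cite: SerreLocalFields1979, Ch. I §6] -/
theorem star_inv_gen (hσσ : ∀ a, σO (σO a) = a) (hσ₁σ₁ : ∀ z, σ₁ (σ₁ z) = z) (z : 𝒪[E] × O₁) :
    RingHom.prodMap σO σ₁ (RingHom.prodMap σO σ₁ z) = z := by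
  obtain ⟨a, w⟩ := z
  change (σO (σO a), σ₁ (σ₁ w)) = (a, w)
  rw [hσσ, hσ₁σ₁]

/-! ## §2 The fixed and anti-fixed parts of `R` in the `⋆`-adapted basis -/

section StarParts

variable [IsDiscreteValuationRing 𝒪[E]]
  (hθ : θ ^ 2 = j k₀) (hcoord : ∀ z : O₁, ∃! bc : 𝒪[E] × 𝒪[E], z = j bc.1 + j bc.2 * θ)
  (h2 : e₂ * 2 = 1) (hD : 4 * D = t * t - y * y * k₀) (hlam : lam = j (e₂ * t) + j (e₂ * y) * θ) (hϖ : IsUniformizingElement ϖ)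
  (hn : valuation E ((u * u - t * u + D : 𝒪[E]) : E) = valuation E ϖ ^ n) (hN : valuation E ((y : 𝒪[E]) : E) = valuation E ϖ ^ N)
  (hσσ : ∀ a, σO (σO a) = a) (hσ₁σ₁ : ∀ z, σ₁ (σ₁ z) = z) (hσ₁j : ∀ a, σ₁ (j a) = j (σO a))
  (hx1 : ((u, lam) : 𝒪[E] × O₁) * RingHom.prodMap σO σ₁ (u, lam) = 1) (huD : IsUnit (u * D))
  {ϖO : 𝒪[E]} (hcoordE : ∀ a : 𝒪[E], ∃! bc : 𝒪[F] × 𝒪[F], a = ιO bc.1 + ιO bc.2 * ϖO) (hσι : ∀ b, σO (ιO b) = ιO b) (hσϖO : σO ϖO = -ϖO)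
  (h2F : ∀ b : 𝒪[F], b * 2 = 0 → b = 0)

include hθ hcoord h2 hD hlam hϖ hn hN hσσ hσ₁σ₁ hσ₁j hx1 huD hcoordE hσι hσϖO h2F in
/-- **THE FIXED PART `R^⋆ = R ⊓ Λ^⋆` IN COORDINATES**: `r ∈ R` with `⋆r = r` iff `r = (ιO b, j ιO b) + (d, jd)·x + (σd, jσd)·x⋆` for some `b ∈ 𝒪_F`, `d ∈ 𝒪_E` (`⋆` acts on
`{1, x, x⁻¹}`-coordinates by `(d₀, d₁, d₂) ↦ (σd₀, σd₂, σd₁)`; `𝒪_E^σ = ιO 𝒪_F` by ★ `map_eq_self_iff_of_coord`). [cite: Neukirch1999, Ch. I §12] [cite: SerreLocalFields1979, Ch. I §6 Prop. 18] -/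
theorem mem_inf_fixed_iff_exists (r : 𝒪[E] × O₁) :
    r ∈ (Polynomial.eval₂RingHom (RingHom.prod (RingHom.id 𝒪[E]) j) ((u, lam) : 𝒪[E] × O₁)).range.toAddSubgroup ⊓
        (RingHom.eqLocus (RingHom.prodMap σO σ₁) (RingHom.id (𝒪[E] × O₁))).toAddSubgroup ↔
      ∃ (b : 𝒪[F]) (d : 𝒪[E]), r = RingHom.prod (RingHom.id 𝒪[E]) j (ιO b) + RingHom.prod (RingHom.id 𝒪[E]) j d * (u, lam) +
        RingHom.prod (RingHom.id 𝒪[E]) j (σO d) * RingHom.prodMap σO σ₁ (u, lam) := by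
  set R := (Polynomial.eval₂RingHom (RingHom.prod (RingHom.id 𝒪[E]) j) ((u, lam) : 𝒪[E] × O₁)).range with hR
  set κ : 𝒪[E] →+* 𝒪[E] × O₁ := RingHom.prod (RingHom.id 𝒪[E]) j with hκ
  set x : 𝒪[E] × O₁ := (u, lam) with hx
  set st : 𝒪[E] × O₁ →+* 𝒪[E] × O₁ := RingHom.prodMap σO σ₁ with hst
  have hstκ : ∀ c, st (κ c) = κ (σO c) := star_const σO j σ₁ hσ₁j
  have hstst : ∀ z, st (st z) = z := star_inv_gen σO σ₁ hσσ hσ₁σ₁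
  have hxiR : st x ∈ R := inv_gen_mem_range_eval₂ j θ u hθ h2 hD hlam huD hx1
  have hmem : r ∈ R.toAddSubgroup ⊓ (RingHom.eqLocus st (RingHom.id (𝒪[E] × O₁))).toAddSubgroup ↔ r ∈ R ∧ st r = r := by
    rw [AddSubgroup.mem_inf]; rfl
  rw [hmem]
  constructor
  · rintro ⟨hr, hfix⟩
    obtain ⟨d, hd⟩ := exists_inv_coord_of_mem_range j θ u hθ h2 hD hlam hx1 hr
    -- `⋆r` in coordinates `(σd₀, σd₂, σd₁)`
    have hstar : st r = κ (σO (d 0)) + κ (σO (d 2)) * x + κ (σO (d 1)) * st x := by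
      rw [hd, map_add, map_add, map_mul, map_mul, hstκ, hstκ, hstκ, hstst]; ring
    have hEq : κ (d 0) + κ (d 1) * x + κ (d 2) * st x = κ (σO (d 0)) + κ (σO (d 2)) * x + κ (σO (d 1)) * st x := by
      rw [← hstar, hfix]; exact hd.symm
    have huniq := inv_coord_injective j θ u hθ hcoord h2 hD hlam hϖ hn hN hx1 (d := d) (d' := ![σO (d 0), σO (d 2), σO (d 1)])
      (by simpa only [Matrix.cons_val_zero, Matrix.cons_val_one, Matrix.cons_val_two, Matrix.tail_cons, Matrix.head_cons] using hEq)
    have h0 : σO (d 0) = d 0 := by have := congrFun huniq 0; simpa using this.symm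
    have h2' : d 2 = σO (d 1) := by have := congrFun huniq 2; simpa using this
    obtain ⟨b, hb⟩ := (map_eq_self_iff_of_coord ιO ϖO hcoordE σO hσι hσϖO h2F (d 0)).1 h0
    exact ⟨b, d 1, by rw [hd, hb, h2']⟩
  · rintro ⟨b, d, rfl⟩
    refine ⟨R.add_mem (R.add_mem (const_mem_range_eval₂ j u _) (R.mul_mem (const_mem_range_eval₂ j u _) (gen_mem_range_eval₂ j u)))
      (R.mul_mem (const_mem_range_eval₂ j u _) hxiR), ?_⟩
    simp only [map_add, map_mul, hstκ, hstst, hσι, hσσ]; ring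

include hθ hcoord h2 hD hlam hϖ hn hN hσσ hσ₁σ₁ hσ₁j hx1 huD hcoordE hσι hσϖO h2F in
/-- **THE ANTI-FIXED PART `R⁻ = R ⊓ ker(⋆ + id)` IN COORDINATES**: `r ∈ R` with `⋆r + r = 0` iff `r = (ιO b·Π, j(ιO b·Π)) + (d, jd)·x − (σd, jσd)·x⋆` (`𝒪_E⁻ = ιO 𝒪_F·Π` by
★ `map_add_self_eq_zero_iff_of_coord`). [cite: Neukirch1999, Ch. I §12] [cite: SerreLocalFields1979, Ch. I §6 Prop. 18] -/
theorem mem_inf_anti_iff_exists (r : 𝒪[E] × O₁) :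
    r ∈ (Polynomial.eval₂RingHom (RingHom.prod (RingHom.id 𝒪[E]) j) ((u, lam) : 𝒪[E] × O₁)).range.toAddSubgroup ⊓
        ((RingHom.prodMap σO σ₁ : 𝒪[E] × O₁ →+* 𝒪[E] × O₁).toAddMonoidHom + AddMonoidHom.id (𝒪[E] × O₁)).ker ↔
      ∃ (b : 𝒪[F]) (d : 𝒪[E]), r = RingHom.prod (RingHom.id 𝒪[E]) j (ιO b * ϖO) + RingHom.prod (RingHom.id 𝒪[E]) j d * (u, lam) -
        RingHom.prod (RingHom.id 𝒪[E]) j (σO d) * RingHom.prodMap σO σ₁ (u, lam) := by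
  set R := (Polynomial.eval₂RingHom (RingHom.prod (RingHom.id 𝒪[E]) j) ((u, lam) : 𝒪[E] × O₁)).range with hR
  set κ : 𝒪[E] →+* 𝒪[E] × O₁ := RingHom.prod (RingHom.id 𝒪[E]) j with hκ
  set x : 𝒪[E] × O₁ := (u, lam) with hx
  set st : 𝒪[E] × O₁ →+* 𝒪[E] × O₁ := RingHom.prodMap σO σ₁ with hst
  have hstκ : ∀ c, st (κ c) = κ (σO c) := star_const σO j σ₁ hσ₁j
  have hstst : ∀ z, st (st z) = z := star_inv_gen σO σ₁ hσσ hσ₁σ₁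
  have hxiR : st x ∈ R := inv_gen_mem_range_eval₂ j θ u hθ h2 hD hlam huD hx1
  have hmem : r ∈ R.toAddSubgroup ⊓ ((st : 𝒪[E] × O₁ →+* 𝒪[E] × O₁).toAddMonoidHom + AddMonoidHom.id (𝒪[E] × O₁)).ker ↔ r ∈ R ∧ st r + r = 0 := by
    rw [AddSubgroup.mem_inf, AddMonoidHom.mem_ker]; rfl
  rw [hmem]
  constructor
  · rintro ⟨hr, hanti⟩
    obtain ⟨d, hd⟩ := exists_inv_coord_of_mem_range j θ u hθ h2 hD hlam hx1 hr
    have hsum : st r + r = κ (σO (d 0) + d 0) + κ (σO (d 2) + d 1) * x + κ (σO (d 1) + d 2) * st x := by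
      rw [hd, map_add, map_add, map_mul, map_mul, hstκ, hstκ, hstκ, hstst, map_add, map_add, map_add]; ring
    have hzero : κ 0 + κ 0 * x + κ 0 * st x = κ (σO (d 0) + d 0) + κ (σO (d 2) + d 1) * x + κ (σO (d 1) + d 2) * st x := by
      rw [← hsum, hanti, map_zero]; ring
    have huniq := inv_coord_injective j θ u hθ hcoord h2 hD hlam hϖ hn hN hx1 (d := ![0, 0, 0]) (d' := ![σO (d 0) + d 0, σO (d 2) + d 1, σO (d 1) + d 2])
      (by simpa only [Matrix.cons_val_zero, Matrix.cons_val_one, Matrix.cons_val_two, Matrix.tail_cons, Matrix.head_cons] using hzero)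
    have h0 : σO (d 0) + d 0 = 0 := by have := congrFun huniq 0; simpa using this.symm
    have h2' : σO (d 1) + d 2 = 0 := by have := congrFun huniq 2; simpa using this.symm
    obtain ⟨b, hb⟩ := (map_add_self_eq_zero_iff_of_coord ιO ϖO hcoordE σO hσι hσϖO h2F (d 0)).1 h0
    refine ⟨b, d 1, ?_⟩
    rw [hd, hb, show d 2 = -σO (d 1) by linear_combination h2', map_neg]; ring
  · rintro ⟨b, d, rfl⟩
    refine ⟨R.sub_mem (R.add_mem (const_mem_range_eval₂ j u _) (R.mul_mem (const_mem_range_eval₂ j u _) (gen_mem_range_eval₂ j u)))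
      (R.mul_mem (const_mem_range_eval₂ j u _) hxiR), ?_⟩
    simp only [map_sub, map_add, map_mul, map_neg, hstκ, hstst, hσι, hσϖO, hσσ]; ring

/-! ## §3 The anti-fixed defect `[R⁻ : Π·R^⋆] = q` -/

include hθ hcoord h2 hD hlam hϖ hn hN hσσ hσ₁σ₁ hσ₁j hx1 huD hcoordE hσι hσϖO h2F in
/-- **THE ANTI-FIXED DEFECT `[R⁻ : Π·R^⋆] = #𝓀_E = q`** for the type-(2) order `R = 𝒪_E[x] ≤ 𝒪_E × O₁` at a TAMELY RAMIFIED base, in the spelling of ★ p846932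
`index_mul_relIndex_map_eq_sq_mul` (`R^⋆ = R ⊓ eqLocus ⋆ id`, `R⁻ = R ⊓ ker(⋆ + id)`, `Π·R^⋆ = (R^⋆).map (mulLeft (Π, jΠ))`, `Π` the anti-fixed uniformiser of `𝒪_E`).
Proof: along the injective parametrisation `(b, d) ↦ (ιO b·Π) + d·x − σd·x⋆` of `R⁻` by `𝒪_F × 𝒪_E` (§2), `Π·R^⋆` is the image of `𝒪_F × Π𝒪_E`
(`Π·(ιO b + d x + σd x⋆) = ιO b·Π + (Πd)x − σ(Πd)x⋆`), so the index is `[𝒪_E : Π𝒪_E] = #(𝒪_E ∕ (Π)) = #𝓀_E`. [cite: Neukirch1999, Ch. I §12] [cite: SerreLocalFields1979, Ch. V §3]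
[cite: Hungerford1974, Ch. I Thm. 4.5] -/
theorem relIndex_map_mulLeft_fixed_anti_eq_natCard (hϖOv : valuation E ((ϖO : 𝒪[E]) : E) = valuation E ϖ) :
    (((Polynomial.eval₂RingHom (RingHom.prod (RingHom.id 𝒪[E]) j) ((u, lam) : 𝒪[E] × O₁)).range.toAddSubgroup ⊓
          (RingHom.eqLocus (RingHom.prodMap σO σ₁) (RingHom.id (𝒪[E] × O₁))).toAddSubgroup).map
        (AddMonoidHom.mulLeft ((ϖO, j ϖO) : 𝒪[E] × O₁))).relIndex
      ((Polynomial.eval₂RingHom (RingHom.prod (RingHom.id 𝒪[E]) j) ((u, lam) : 𝒪[E] × O₁)).range.toAddSubgroup ⊓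
        ((RingHom.prodMap σO σ₁ : 𝒪[E] × O₁ →+* 𝒪[E] × O₁).toAddMonoidHom + AddMonoidHom.id (𝒪[E] × O₁)).ker) = Nat.card 𝓀[E] := by
  classical
  set R := (Polynomial.eval₂RingHom (RingHom.prod (RingHom.id 𝒪[E]) j) ((u, lam) : 𝒪[E] × O₁)).range with hR
  set κ : 𝒪[E] →+* 𝒪[E] × O₁ := RingHom.prod (RingHom.id 𝒪[E]) j with hκ
  set x : 𝒪[E] × O₁ := (u, lam) with hx
  set st : 𝒪[E] × O₁ →+* 𝒪[E] × O₁ := RingHom.prodMap σO σ₁ with hst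
  set Fix : AddSubgroup (𝒪[E] × O₁) := R.toAddSubgroup ⊓ (RingHom.eqLocus st (RingHom.id (𝒪[E] × O₁))).toAddSubgroup with hFix
  set Anti : AddSubgroup (𝒪[E] × O₁) := R.toAddSubgroup ⊓ ((st : 𝒪[E] × O₁ →+* 𝒪[E] × O₁).toAddMonoidHom + AddMonoidHom.id (𝒪[E] × O₁)).ker with hAnti
  have hπκ : ((ϖO, j ϖO) : 𝒪[E] × O₁) = κ ϖO := rfl
  -- the parametrisation `α` of `R⁻` by `𝒪_F × 𝒪_E`
  set α : 𝒪[F] × 𝒪[E] →+ 𝒪[E] × O₁ :=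
    AddMonoidHom.mk' (fun p => κ (ιO p.1 * ϖO) + κ p.2 * x - κ (σO p.2) * st x) (fun p p' => by
      simp only [Prod.fst_add, Prod.snd_add, map_add, map_mul]; ring) with hα
  have hαapp : ∀ p : 𝒪[F] × 𝒪[E], α p = κ (ιO p.1 * ϖO) + κ p.2 * x - κ (σO p.2) * st x := fun _ => rfl
  -- `R⁻ = α(⊤)`
  have hAntiEq : Anti = (⊤ : AddSubgroup (𝒪[F] × 𝒪[E])).map α := by
    ext r
    rw [hAnti, mem_inf_anti_iff_exists ιO σO j σ₁ θ u hθ hcoord h2 hD hlam hϖ hn hN hσσ hσ₁σ₁ hσ₁j hx1 huD hcoordE hσι hσϖO h2F r, AddSubgroup.mem_map]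
    constructor
    · rintro ⟨b, d, rfl⟩
      exact ⟨(b, d), AddSubgroup.mem_top _, (hαapp (b, d)).trans rfl⟩
    · rintro ⟨p, -, rfl⟩
      exact ⟨p.1, p.2, hαapp p⟩
  -- `Π·R^⋆ = α(𝒪_F × Π𝒪_E)`
  set P : AddSubgroup 𝒪[E] := (⊤ : AddSubgroup 𝒪[E]).map (AddMonoidHom.mulLeft ϖO) with hP
  have hFixEq : Fix.map (AddMonoidHom.mulLeft ((ϖO, j ϖO) : 𝒪[E] × O₁)) = ((⊤ : AddSubgroup 𝒪[F]).prod P).map α := by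
    ext r
    rw [AddSubgroup.mem_map, AddSubgroup.mem_map]
    constructor
    · rintro ⟨s, hs, rfl⟩
      obtain ⟨b, d, rfl⟩ := (mem_inf_fixed_iff_exists ιO σO j σ₁ θ u hθ hcoord h2 hD hlam hϖ hn hN hσσ hσ₁σ₁ hσ₁j hx1 huD hcoordE hσι hσϖO h2F _).1 (by rw [hFix] at hs; exact hs)
      refine ⟨(b, ϖO * d), AddSubgroup.mem_prod.2 ⟨AddSubgroup.mem_top _, AddSubgroup.mem_map.2 ⟨d, AddSubgroup.mem_top _, rfl⟩⟩, ?_⟩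
      rw [hαapp, AddMonoidHom.coe_mulLeft, hπκ]
      simp only [map_mul, hσϖO, map_neg]
      ring
    · rintro ⟨⟨b, d'⟩, hmem, rfl⟩
      obtain ⟨-, hd'⟩ := AddSubgroup.mem_prod.1 hmem
      obtain ⟨d, -, rfl⟩ := AddSubgroup.mem_map.1 hd'
      refine ⟨κ (ιO b) + κ d * x + κ (σO d) * st x, ?_, ?_⟩
      · rw [hFix]
        exact (mem_inf_fixed_iff_exists ιO σO j σ₁ θ u hθ hcoord h2 hD hlam hϖ hn hN hσσ hσ₁σ₁ hσ₁j hx1 huD hcoordE hσι hσϖO h2F _).2 ⟨b, d, rfl⟩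
      · rw [hαapp, AddMonoidHom.coe_mulLeft, AddMonoidHom.coe_mulLeft, hπκ]
        simp only [map_mul, hσϖO, map_neg]
        ring
  -- `α` is injective (unique `{1, x, x⁻¹}`-coordinates; `Π ≠ 0`, `ιO` injective, `𝒪_E` a domain)
  have hϖO0 : ϖO ≠ 0 := by
    intro h0
    have h' := hϖOv
    rw [h0, ZeroMemClass.coe_zero, map_zero] at h'
    exact ((Valuation.ne_zero_iff _).2 hϖ.ne_zero) h'.symm
  have hιinj : Function.Injective ιO := by
    intro b b' hbb
    have h' : ιO b + ιO 0 * ϖO = ιO b' + ιO 0 * ϖO := by rw [hbb]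
    exact (coord_unique ιO ϖO hcoordE h').1
  have hαinj : Function.Injective α := by
    intro p p' hpp
    have h' : κ (ιO p.1 * ϖO) + κ p.2 * x + κ (-σO p.2) * st x = κ (ιO p'.1 * ϖO) + κ p'.2 * x + κ (-σO p'.2) * st x := by
      have e := hpp
      rw [hαapp, hαapp] at e
      simpa only [map_neg, neg_mul, ← sub_eq_add_neg] using e
    have huniq := inv_coord_injective j θ u hθ hcoord h2 hD hlam hϖ hn hN hx1
      (d := ![ιO p.1 * ϖO, p.2, -σO p.2]) (d' := ![ιO p'.1 * ϖO, p'.2, -σO p'.2])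
      (by simpa only [Matrix.cons_val_zero, Matrix.cons_val_one, Matrix.cons_val_two, Matrix.tail_cons, Matrix.head_cons] using h')
    have h0 : ιO p.1 * ϖO = ιO p'.1 * ϖO := by have := congrFun huniq 0; simpa using this
    have h1 : p.2 = p'.2 := by have := congrFun huniq 1; simpa using this
    exact Prod.ext (hιinj (mul_right_cancel₀ hϖO0 h0)) h1
  -- the index
  rw [hFixEq, hAntiEq, AddSubgroup.relIndex_map_map_of_injective _ _ hαinj, AddSubgroup.relIndex_top_right, AddSubgroup.index_prod,
    AddSubgroup.index_top, one_mul]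
  -- `[𝒪_E : Π𝒪_E] = #(𝒪_E ⧸ (Π)) = #𝓀_E`
  have hPspan : P = (Ideal.span ({ϖO} : Set 𝒪[E])).toAddSubgroup := by
    ext a
    rw [hP, AddSubgroup.mem_map, Submodule.mem_toAddSubgroup, Ideal.mem_span_singleton']
    constructor
    · rintro ⟨d, -, rfl⟩
      exact ⟨d, by rw [AddMonoidHom.coe_mulLeft, mul_comm]⟩
    · rintro ⟨d, rfl⟩
      exact ⟨d, AddSubgroup.mem_top _, by rw [AddMonoidHom.coe_mulLeft, mul_comm]⟩
  have hidx : (Ideal.span ({ϖO} : Set 𝒪[E])).toAddSubgroup.index = Nat.card (𝒪[E] ⧸ Ideal.span ({ϖO} : Set 𝒪[E])) := rfl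
  rw [hPspan, hidx, natCard_quotient_span_singleton_of_valuation_eq hϖ (N := 1) (by rw [pow_one]; exact hϖOv), pow_one]

end StarParts
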